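import Literature.AlgebraicGeometry.Resolution.DefectTransport
import HarnessLib

/-!
# Defectlessness in towers of finite extensions

Topic: `Literature/AlgebraicGeometry/Resolution` (valued function fields). PROVED bookkeeping for the
finite-level proof of Kuhlmann 2010, Cor. 2.25 (`Kuhlmann2010DefectlessDescent`): the behaviour of
"`(K, K°)` is defectless in `L`" (`IsDefectlessIn`, `ValuationDefect.lean`: `∑ eᵢ fᵢ = [L : K]` over
all extensions of `K°` to `L`) in a tower `K → L → M` of finite extensions, from the fundamental
inequality `∑ eᵢ fᵢ ≤ n` (`FundamentalInequality_holds`, `GeneralizedStabilityProofs.lean`) and the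
multiplicativity of `e` and `f` (`ramificationIndex_tower`, `inertiaDegree_tower`). This is the
finite-level substitute for the multiplicativity of the defect (Kuhlmann 2010, Lemma 2.13:
"`d(M|K,v) = d(M|L,v)·d(L|K,v)` … `(M|K,v)` is defectless if and only if `(M|L,v)` and `(L|K,v)`
are defectless"), which the source states for henselian fields.

## Content (everything PROVED)

* `IsDefectlessIn.of_tower_top` — if `K°` is defectless in `M` then it is defectless in the
  intermediate field `L` (grouping the extensions of `K°` to `M` by their restrictions to `L`:
  `[M : K] = ∑_{O₁} e f(O₁/K) ∑_{O'' | O₁} e f(O''/L) ≤ (∑_{O₁} e f(O₁/K)) [M : L] ≤ [L : K][M : L]`).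
* `IsDefectlessIn.tower` — conversely, if `K°` is defectless in `L` and EVERY extension `O₁` of
  `K°` to `L` is defectless in `M`, then `K°` is defectless in `M`.
* `sum_eq_card_mul_of_forall_exists_algEquiv` — if all extensions of `K°` to `L` are conjugate to a
  fixed one `W` under `K`-automorphisms, then `∑ e f = #{extensions} · e(W) f(W)`.

## Sources

* F.-V. Kuhlmann, Trans. AMS 362 (2010) = arXiv:1003.5678, §2.3, Lemma 2.13 (p. 7). [folklore]
-/

noncomputable section

open IsLocalRing

namespace Literature.AlgebraicGeometry.Resolution

universe u

section Tower

variable {K L M : Type u} [Field K] [Field L] [Field M] [Algebra K L] [Algebra L M] [Algebra K M]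
  [IsScalarTower K L M] (O : ValuationSubring K)

/-- Restriction to `K` factors through `L` in a tower `K → L → M`. [folklore] -/
theorem comap_algebraMap_tower (O'' : ValuationSubring M) :
    O''.comap (algebraMap K M) = (O''.comap (algebraMap L M)).comap (algebraMap K L) := by
  rw [ValuationSubring.comap_comap, ← IsScalarTower.algebraMap_eq K L M]

/-- **Defectless in the top of a tower ⇒ defectless in the middle** (finite-level form of one half
of Kuhlmann 2010, Lemma 2.13): for `K → L → M` finite, if `(K, K°)` is defectless in `M` then it
is defectless in `L`. PROVED from the fundamental inequality. [cite: Kuhlmann2010, Lemma 2.13] -/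
theorem IsDefectlessIn.of_tower_top [FiniteDimensional K L] [FiniteDimensional L M]
    (h : IsDefectlessIn K O M) : IsDefectlessIn K O L := by
  classical
  haveI : FiniteDimensional K M := Module.Finite.trans L M
  obtain ⟨sM, hsM, hsumM⟩ := h
  obtain ⟨sL, hsL, hleL⟩ := FundamentalInequality_holds K L inferInstance O
  choose t ht hle using fun O₁ : ValuationSubring L => FundamentalInequality_holds L M inferInstance O₁
  have hmaps : ∀ O'' ∈ sM, O''.comap (algebraMap L M) ∈ sL := fun O'' hO'' => by
    rw [hsL, ← comap_algebraMap_tower (L := L)]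
    exact (hsM O'').mp hO''
  have hfib : ∀ O₁ ∈ sL,
      sM.filter (fun O'' => O''.comap (algebraMap L M) = O₁) = t O₁ := fun O₁ hO₁ => by
    ext O''
    rw [Finset.mem_filter, hsM, ht, comap_algebraMap_tower (L := L)]
    constructor
    · exact fun h => h.2
    · intro hc
      exact ⟨by rw [hc]; exact (hsL O₁).mp hO₁, hc⟩
  have hkey : Module.finrank K M = ∑ O₁ ∈ sL, ramificationIndex K O₁ * inertiaDegree K O₁ *
      ∑ O'' ∈ t O₁, ramificationIndex L O'' * inertiaDegree L O'' := by
    rw [← hsumM, ← Finset.sum_fiberwise_of_maps_to hmaps]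
    refine Finset.sum_congr rfl fun O₁ hO₁ => ?_
    rw [hfib O₁ hO₁, Finset.mul_sum]
    refine Finset.sum_congr rfl fun O'' hO'' => ?_
    have hc : O''.comap (algebraMap L M) = O₁ := (ht O₁ O'').mp hO''
    rw [ramificationIndex_tower K L O'', inertiaDegree_tower K L O'', hc]
    ring
  have hbound : ∀ O₁ ∈ sL, ramificationIndex K O₁ * inertiaDegree K O₁ *
      ∑ O'' ∈ t O₁, ramificationIndex L O'' * inertiaDegree L O'' ≤
      ramificationIndex K O₁ * inertiaDegree K O₁ * Module.finrank L M :=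
    fun O₁ _ => Nat.mul_le_mul_left _ (hle O₁)
  have h1 : Module.finrank K M ≤ (∑ O₁ ∈ sL, ramificationIndex K O₁ * inertiaDegree K O₁) *
      Module.finrank L M := by
    rw [hkey, Finset.sum_mul]
    exact Finset.sum_le_sum hbound
  have h2 : (∑ O₁ ∈ sL, ramificationIndex K O₁ * inertiaDegree K O₁) * Module.finrank L M ≤
      Module.finrank K L * Module.finrank L M := Nat.mul_le_mul_right _ hleL
  rw [← Module.finrank_mul_finrank K L M] at h1
  have hpos : 0 < Module.finrank L M := Module.finrank_pos
  refine ⟨sL, hsL, le_antisymm hleL ?_⟩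
  exact Nat.le_of_mul_le_mul_right (le_trans h1 (le_refl _)) hpos

/-- **Defectless in both steps of a tower ⇒ defectless in the tower** (finite-level form of the
other half of Kuhlmann 2010, Lemma 2.13): for `K → L → M` finite, if `(K, K°)` is defectless in
`L` and `(L, O₁)` is defectless in `M` for EVERY extension `O₁` of `K°` to `L`, then `(K, K°)` is
defectless in `M`. PROVED. [cite: Kuhlmann2010, Lemma 2.13] -/
theorem IsDefectlessIn.tower [FiniteDimensional K L] [FiniteDimensional L M]
    (hL : IsDefectlessIn K O L)
    (hM : ∀ O₁ : ValuationSubring L, O₁.comap (algebraMap K L) = O → IsDefectlessIn L O₁ M) :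
    IsDefectlessIn K O M := by
  classical
  haveI : FiniteDimensional K M := Module.Finite.trans L M
  obtain ⟨sL, hsL, hsumL⟩ := hL
  choose t ht hsum using hM
  -- all extensions of `K°` to `M`, grouped by their restriction to `L`
  let T : ValuationSubring L → Finset (ValuationSubring M) := fun O₁ =>
    if h₁ : O₁.comap (algebraMap K L) = O then t O₁ h₁ else ∅
  have hT : ∀ O₁ (h₁ : O₁.comap (algebraMap K L) = O), T O₁ = t O₁ h₁ := fun O₁ h₁ => by
    simp only [T, dif_pos h₁]
  refine ⟨sL.biUnion T, fun O'' => ?_, ?_⟩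
  · rw [Finset.mem_biUnion]
    constructor
    · rintro ⟨O₁, hO₁, hO''⟩
      have h₁ := (hsL O₁).mp hO₁
      rw [hT O₁ h₁, ht O₁ h₁] at hO''
      rw [comap_algebraMap_tower (L := L), hO'', h₁]
    · intro hO''
      have h₁ : (O''.comap (algebraMap L M)).comap (algebraMap K L) = O := by
        rw [← comap_algebraMap_tower (L := L), hO'']
      refine ⟨O''.comap (algebraMap L M), (hsL _).mpr h₁, ?_⟩
      rw [hT _ h₁, ht _ h₁]
  · have hdisj : (sL : Set (ValuationSubring L)).PairwiseDisjoint T := by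
      intro O₁ hO₁ O₂ hO₂ hne
      have h₁ := (hsL O₁).mp hO₁
      have h₂ := (hsL O₂).mp hO₂
      rw [Function.onFun, Finset.disjoint_left]
      intro O'' hO''₁ hO''₂
      rw [hT O₁ h₁, ht O₁ h₁] at hO''₁
      rw [hT O₂ h₂, ht O₂ h₂] at hO''₂
      exact hne (hO''₁.symm.trans hO''₂)
    rw [Finset.sum_biUnion hdisj, ← Module.finrank_mul_finrank K L M, ← hsumL, Finset.sum_mul]
    refine Finset.sum_congr rfl fun O₁ hO₁ => ?_
    have h₁ := (hsL O₁).mp hO₁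
    rw [hT O₁ h₁, ← hsum O₁ h₁, Finset.mul_sum]
    refine Finset.sum_congr rfl fun O'' hO'' => ?_
    have hc : O''.comap (algebraMap L M) = O₁ := (ht O₁ h₁ O'').mp hO''
    rw [ramificationIndex_tower K L O'', inertiaDegree_tower K L O'', hc]
    ring

end Tower

section Orbit

variable (K : Type u) {L : Type u} [Field K] [Field L] [Algebra K L]

/-- **Conjugate extensions contribute equally**: if every member of a finite set `s` of valuation
rings of `L` is of the form `σ⁻¹(W)` for a `K`-automorphism `σ` of `L` and a fixed `W`, then
`∑_{W' ∈ s} e(W'/K) f(W'/K) = #s · e(W/K) f(W/K)`. PROVED (`e`, `f` are invariant under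
`K`-automorphisms, `DefectTransport.lean`). [folklore] -/
theorem sum_eq_card_mul_of_forall_exists_algEquiv (s : Finset (ValuationSubring L))
    (W : ValuationSubring L) (h : ∀ W' ∈ s, ∃ σ : L ≃ₐ[K] L, W.comap (σ : L →+* L) = W') :
    ∑ W' ∈ s, ramificationIndex K W' * inertiaDegree K W' =
      s.card * (ramificationIndex K W * inertiaDegree K W) := by
  rw [Finset.card_eq_sum_ones, Finset.sum_mul, one_mul]
  refine Finset.sum_congr rfl fun W' hW' => ?_
  obtain ⟨σ, rfl⟩ := h W' hW'
  rw [ramificationIndex_comap_algEquiv, inertiaDegree_comap_algEquiv]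

end Orbit

end Literature.AlgebraicGeometry.Resolution
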